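import Summits.CriticalPhenomena.PercolationContinuityZ3.Theorems.PercNearOneGluingNoHeavyLowerTailSwitchRelaxTower4Sub3Merged
import Summits.CriticalPhenomena.PercolationContinuityZ3.Theorems.PercNearOneGluingNoHeavyLowerTailSwitchRelaxTower4Sub3Measure
import Summits.CriticalPhenomena.PercolationContinuityZ3.Theorems.PercNearOneGluingNoHeavyLowerTailSwitchRelaxCubic
import Literature.Probability.LatticeModels.SahiThirdOrderCorrelation
import Mathlib.Tactic.Linarith
import HarnessLib

/-!
# `NoHeavyLowerTail` (stmt-CriticalPhenomena-4575) — THEOREM `tow3m` on EVERY finite weighted graph from its switching certificate: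
# `0 ≤ E₃(NN:bc,cy;ab,bc, N:ac,cy, N:ab,by)` (finite-relaxation replay, measure level)

Support file (prover prim-masterthm-p1 gen 5, generator of prim-cert-2 gen 12; `--supports stmt-CriticalPhenomena-4575`).  No named facts, no sorries.

From `…SwitchRelaxTower4Sub3Merged` (the certificate as data and its SCALABLE kernel check, parts IIc–IIe ⇒ `S ≤ 0` pointwise) and `…SwitchRelaxExpectation`
(`E[S] = ES cert P` in the type masses, `P t = cell w a b c y t`; the potentials are their entry lists by definition):
the cubic identity `Σλ₀ + σ·Σλ_p + 4·E₃ʰᵒᵐ ≡ 0` checked coefficientwise by the kernel (`cubic_ok`, part III b `cubicCheck`),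
the dictionary "event = sum of cells" for the seven events of `E₃`, and the theorem `sahiE3_nonneg` (`cubic_sound`, `Σ cells = 1`).
Source certificate: prim-masterthm-p1 gen 5 `cert_tow3m_L2_j137170.json` (identity re-verified in exact arithmetic by this seat).
-/

noncomputable section

namespace Summit.CriticalPhenomena.PercolationContinuityZ3.Theorems

namespace SwitchRelax

namespace Tower4Sub3Merged

open Finset MeasureTheory Set Literature.Probability.Percolation Literature.Probability.LatticeModels FourPointAtoms
open Summit.CriticalPhenomena.PercolationContinuityZ3.Cruxes.AdditiveGluing.TieLine.ConnAtoms
open scoped Classical BigOperators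


/-! ### The cubic identity (kernel, reflective: `cubicCheck` of part III b) -/

/-- The certificate's cubic identity `Σλ₀ + σ·Σλ_p + 4·E₃ʰᵒᵐ ≡ 0` in the 15 type masses, checked coefficientwise by the
kernel (the events `A`, `B`, `C`, `A∩B`, `A∩C`, `B∩C`, `A∩B∩C` as cell lists). [this work] -/
theorem cubic_ok : cubicCheck Tower4Sub3Merged.T03 Tower4Sub3Merged.TPb 4 [0, 1, 2, 3, 4, 5, 6, 8, 9, 10, 11, 12] [0, 1, 2, 3, 4, 5, 6, 7, 8, 9, 11, 12, 13] [0, 1, 2, 3, 4, 5, 6, 7, 8, 9, 10, 11, 13] [0, 1, 2, 3, 4, 5, 6, 8, 9, 11, 12] [0, 1, 2, 3, 4, 5, 6, 8, 9, 10, 11] [0, 1, 2, 3, 4, 5, 6, 7, 8, 9, 11, 13] [0, 1, 2, 3, 4, 5, 6, 8, 9, 11] = true := by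
  decide +kernel

/-! ### The dictionary and the theorem for `prodBernoulli w` -/

section Measure

variable {V : Type*} [Fintype V] (w : Sym2 V → unitInterval) (a b c y : V)

/-- Dictionary entry: the event `(openConn b c ∩ openConn c y)ᶜ ∩ (openConn a b ∩ openConn b c)ᶜ` as a sum of four-point cells. -/
theorem rE0 : (prodBernoulli w).real ((openConn b c ∩ openConn c y)ᶜ ∩ (openConn a b ∩ openConn b c)ᶜ) =
    cell w a b c y 0 + cell w a b c y 1 + cell w a b c y 2 + cell w a b c y 3 + cell w a b c y 4 + cell w a b c y 5 + cell w a b c y 6 + cell w a b c y 8 + cell w a b c y 9 + cell w a b c y 10 + cell w a b c y 11 + cell w a b c y 12 := by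
  rw [measureReal_eq_cellSum w a b c y (show HasPattern (quad a b c y) ((openConn b c ∩ openConn c y)ᶜ ∩ (openConn a b ∩ openConn b c)ᶜ) _ from
    ((((((oc a b c y 1 2 rfl rfl)).inter (oc a b c y 2 3 rfl rfl))).compl).inter ((((oc a b c y 0 1 rfl rfl)).inter (oc a b c y 1 2 rfl rfl))).compl))]
  simp (config := {decide := true}) only [ite_true, ite_false]; ring

/-- Dictionary entry: the event `(openConn b c ∩ openConn c y)ᶜ ∩ (openConn a b ∩ openConn b c)ᶜ ∩ (openConn a c ∩ openConn` as a sum of four-point cells. -/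
theorem rE1 : (prodBernoulli w).real ((openConn b c ∩ openConn c y)ᶜ ∩ (openConn a b ∩ openConn b c)ᶜ ∩ (openConn a c ∩ openConn c y)ᶜ ∩ (openConn a b ∩ openConn b y)ᶜ) =
    cell w a b c y 0 + cell w a b c y 1 + cell w a b c y 2 + cell w a b c y 3 + cell w a b c y 4 + cell w a b c y 5 + cell w a b c y 6 + cell w a b c y 8 + cell w a b c y 9 + cell w a b c y 11 := by
  rw [measureReal_eq_cellSum w a b c y (show HasPattern (quad a b c y) ((openConn b c ∩ openConn c y)ᶜ ∩ (openConn a b ∩ openConn b c)ᶜ ∩ (openConn a c ∩ openConn c y)ᶜ ∩ (openConn a b ∩ openConn b y)ᶜ) _ from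
    ((((((((((oc a b c y 1 2 rfl rfl)).inter (oc a b c y 2 3 rfl rfl))).compl).inter ((((oc a b c y 0 1 rfl rfl)).inter (oc a b c y 1 2 rfl rfl))).compl)).inter ((((oc a b c y 0 2 rfl rfl)).inter (oc a b c y 2 3 rfl rfl))).compl)).inter ((((oc a b c y 0 1 rfl rfl)).inter (oc a b c y 1 3 rfl rfl))).compl))]
  simp (config := {decide := true}) only [ite_true, ite_false]; ring

/-- Dictionary entry: the event `(openConn b c ∩ openConn c y)ᶜ ∩ (openConn a b ∩ openConn b c)ᶜ ∩ (openConn a b ∩ openConn` as a sum of four-point cells. -/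
theorem rE2 : (prodBernoulli w).real ((openConn b c ∩ openConn c y)ᶜ ∩ (openConn a b ∩ openConn b c)ᶜ ∩ (openConn a b ∩ openConn b y)ᶜ) =
    cell w a b c y 0 + cell w a b c y 1 + cell w a b c y 2 + cell w a b c y 3 + cell w a b c y 4 + cell w a b c y 5 + cell w a b c y 6 + cell w a b c y 8 + cell w a b c y 9 + cell w a b c y 10 + cell w a b c y 11 := by
  rw [measureReal_eq_cellSum w a b c y (show HasPattern (quad a b c y) ((openConn b c ∩ openConn c y)ᶜ ∩ (openConn a b ∩ openConn b c)ᶜ ∩ (openConn a b ∩ openConn b y)ᶜ) _ from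
    ((((((((oc a b c y 1 2 rfl rfl)).inter (oc a b c y 2 3 rfl rfl))).compl).inter ((((oc a b c y 0 1 rfl rfl)).inter (oc a b c y 1 2 rfl rfl))).compl)).inter ((((oc a b c y 0 1 rfl rfl)).inter (oc a b c y 1 3 rfl rfl))).compl))]
  simp (config := {decide := true}) only [ite_true, ite_false]; ring

/-- Dictionary entry: the event `(openConn b c ∩ openConn c y)ᶜ ∩ (openConn a b ∩ openConn b c)ᶜ ∩ (openConn a c ∩ openConn` as a sum of four-point cells. -/
theorem rE3 : (prodBernoulli w).real ((openConn b c ∩ openConn c y)ᶜ ∩ (openConn a b ∩ openConn b c)ᶜ ∩ (openConn a c ∩ openConn c y)ᶜ) =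
    cell w a b c y 0 + cell w a b c y 1 + cell w a b c y 2 + cell w a b c y 3 + cell w a b c y 4 + cell w a b c y 5 + cell w a b c y 6 + cell w a b c y 8 + cell w a b c y 9 + cell w a b c y 11 + cell w a b c y 12 := by
  rw [measureReal_eq_cellSum w a b c y (show HasPattern (quad a b c y) ((openConn b c ∩ openConn c y)ᶜ ∩ (openConn a b ∩ openConn b c)ᶜ ∩ (openConn a c ∩ openConn c y)ᶜ) _ from
    ((((((((oc a b c y 1 2 rfl rfl)).inter (oc a b c y 2 3 rfl rfl))).compl).inter ((((oc a b c y 0 1 rfl rfl)).inter (oc a b c y 1 2 rfl rfl))).compl)).inter ((((oc a b c y 0 2 rfl rfl)).inter (oc a b c y 2 3 rfl rfl))).compl))]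
  simp (config := {decide := true}) only [ite_true, ite_false]; ring

/-- **THEOREM (tow3m, every finite weighted graph).**  For Bernoulli bond percolation `prodBernoulli w` with arbitrary edge
weights on a finite vertex type and any vertices `a, b, c, y`:  `0 ≤ E₃(A, B, C)` for
`A = (openConn b c ∩ openConn c y)ᶜ ∩ (openConn a b ∩ openConn b c)ᶜ`, `B = (openConn a c ∩ openConn c y)ᶜ`, `C = (openConn a b ∩ openConn b y)ᶜ` — an instance of [Kahn2022, Conj. 5] / Sahi's `C₃`, proved by
prim-masterthm-p1 gen 5's switching certificate replayed through the finite relaxation (`…SwitchRelaxTower4Sub3Merged.Sreal_nonpos`). [this work] -/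
theorem sahiE3_nonneg : 0 ≤ sahiE3 (prodBernoulli w) ((openConn b c ∩ openConn c y)ᶜ ∩ (openConn a b ∩ openConn b c)ᶜ) ((openConn a c ∩ openConn c y)ᶜ) ((openConn a b ∩ openConn b y)ᶜ) := by
  have hp0 : ∀ e, 0 ≤ (w e : ℝ) := fun e => (w e).2.1
  have hp1 : ∀ e, (w e : ℝ) ≤ 1 := fun e => (w e).2.2
  have hES := ES_nonpos_of_Sreal (quad a b c y) cert (Sreal_nonpos (quad a b c y)) hp0 hp1 Finset.univ
  simp only [PrW_tyEv_eq_cell] at hES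
  have hσ : ∑ i, cell w a b c y i = 1 := by rw [sum_univ_explicit]; exact sum_cell_eq_one w a b c y
  have h := cubic_sound cert (fun πX => tabOK_bucket3 ents0 πX) TPb_ok cubic_ok (cell w a b c y) hσ hES
  simp only [S_cons, S_nil, tyOf_lits, add_zero] at h
  rw [sahiE3_def, rE1, rE0, Summit.CriticalPhenomena.PercolationContinuityZ3.Theorems.SwitchRelax.Tower4Sub3.rE1, Summit.CriticalPhenomena.PercolationContinuityZ3.Theorems.SwitchRelax.Tower4Sub3.rE2, Summit.CriticalPhenomena.PercolationContinuityZ3.Theorems.SwitchRelax.Tower4Sub3.rE4, rE2, rE3]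
  linarith [h]

end Measure

end Tower4Sub3Merged

end SwitchRelax

end Summit.CriticalPhenomena.PercolationContinuityZ3.Theorems

end
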